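import Summits.QuantumAdvantage.QuantumAdvantage.Theorems.OddPrimeWalkOddConfig
import Summits.QuantumAdvantage.AdviceFreeQNC0.CleanGapStrategies
import Summits.QuantumAdvantage.QuantumAdvantage.Theses.OddPrimeWalk

/-!
# Item stmt-QuantumAdvantage-23990 `BlindPairLaw` — the BLIND PAIR LAW `8/9` of the u-walk game (route OddPrimeWalk, support, rank 9)

Cell qa-qnc0; planner qa-qnc0-p2 g28/g29 (ROUND-28 THM 1, ROUND-29 §1.1, asks P2-29a/b/c); prover qn-prover-3 g18.

THEOREM (`oddPrimeWalk_blindPairLaw`).  If no cut crosses the separator `m` (cuts `g ≤ m` read only bits `< m`, cuts `g > m` only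
bits `≥ m`; fire rules otherwise ARBITRARY) and both sides have `≥ m₀` bits, then `#WIN_c ≤ (8/9 + 8·2^{-m₀})·2^n`.

PROOF.  §1 inputs factor as `glue m s t` over `A`-parts `s ∈ Aset` (supported below `m`) and `B`-parts `t ∈ Bset` (Fubini
`sum_eq_sum_glue`), each side split into its three weight classes `Acl a` / `Bcl b`.  §2 class sizes: transport to the cubes
`{0,1}^m`, `{0,1}^(n-m)` (`card_Acl`, `card_Bcl`) and the tree's `three_mul_card_class_add_two_ge` give `3·|class| + 2 ≥ 2^side`.
§3 TWO PIGEONHOLES over the planner's odd-configuration corollary `OddConfig.blind_exists_lose` (every system of class representatives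
`p_a ∈ A_a`, `q_b ∈ B_b` has a LOST glued pair): (i) `one_le_sum_cost` — for every `A`-system `p`, `Σ_a cost(p_a) ≥ 1` where
`cost(s) = Σ_b |bad_b(s)|/|B_b|` (else each `B`-class has a member beating all three `p_a`); (ii) `mul_le_card_lose` —
`#LOSE = Σ_s Σ_b |bad_b(s)| ≥ min|B_b| · Σ_a |A_a| · cost(argmin_a) ≥ min|A_a| · min|B_b|`.  §4 arithmetic:
`#WIN ≤ 2^n − (2^m−2)(2^{n−m}−2)/9 ≤ (8/9)2^n + (4/9)2^{n−m₀}` (`blindPairLaw_card`; the regime `m₀ ≤ 6` is trivial).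
WHAT THIS IS NOT: instrument / BC5-type witness for the dense cruxes 23029/23109 (product strategies with dense halves lie outside every
landed rung); no degree hypothesis is used or produced; separation NOT moved.
-/

namespace Summit.QuantumAdvantage.AdviceFreeQNC0.OddConfig

open Finset Classical

variable {n : ℕ}

/-! ### §1 `A`-parts, `B`-parts, classes; Fubini across the separator -/

/-- the inputs supported below the separator `m` (the `A`-parts). -/
def Aset (n m : ℕ) : Finset (Fin n → Bool) :=
  univ.filter fun s => ∀ i : Fin n, ¬ i.val < m → s i = false

/-- the inputs supported at or above the separator `m` (the `B`-parts). -/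
def Bset (n m : ℕ) : Finset (Fin n → Bool) :=
  univ.filter fun t => ∀ i : Fin n, i.val < m → t i = false

/-- the `A`-parts of weight class `a` (mod 3). -/
def Acl (n m a : ℕ) : Finset (Fin n → Bool) := (Aset n m).filter fun s => wtA m s % 3 = a

/-- the `B`-parts of weight class `b` (mod 3). -/
def Bcl (n m b : ℕ) : Finset (Fin n → Bool) := (Bset n m).filter fun t => wtB m t % 3 = b

/-- the low part of an input: its bits `< m`, zero above. -/
def loPart (m : ℕ) (u : Fin n → Bool) : Fin n → Bool := fun i => if i.val < m then u i else false

/-- the high part of an input: its bits `≥ m`, zero below. -/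
def hiPart (m : ℕ) (u : Fin n → Bool) : Fin n → Bool := fun i => if i.val < m then false else u i

/-- an input is the glue of its low and high parts. -/
theorem glue_loPart_hiPart (m : ℕ) (u : Fin n → Bool) : glue m (loPart m u) (hiPart m u) = u := by
  funext i; by_cases h : i.val < m <;> simp [glue, loPart, hiPart, h]

/-- the low part is an `A`-part. -/
theorem loPart_mem_Aset (m : ℕ) (u : Fin n → Bool) : loPart m u ∈ Aset n m := by
  simp only [Aset, mem_filter, mem_univ, true_and]; intro i h; simp [loPart, h]

/-- the high part is a `B`-part. -/
theorem hiPart_mem_Bset (m : ℕ) (u : Fin n → Bool) : hiPart m u ∈ Bset n m := by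
  simp only [Bset, mem_filter, mem_univ, true_and]; intro i h; simp [hiPart, h]

/-- the low part of `glue m s t` is `s` when `s` is an `A`-part. -/
theorem loPart_glue {m : ℕ} {s : Fin n → Bool} (hs : s ∈ Aset n m) (t : Fin n → Bool) :
    loPart m (glue m s t) = s := by
  funext i
  by_cases h : i.val < m
  · simp [loPart, glue, h]
  · simp only [loPart, glue, h, if_false]
    exact ((mem_filter.mp hs).2 i h).symm

/-- the high part of `glue m s t` is `t` when `t` is a `B`-part. -/
theorem hiPart_glue {m : ℕ} {t : Fin n → Bool} (ht : t ∈ Bset n m) (s : Fin n → Bool) :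
    hiPart m (glue m s t) = t := by
  funext i
  by_cases h : i.val < m
  · simp only [hiPart, glue, h, if_true]
    exact ((mem_filter.mp ht).2 i h).symm
  · simp [hiPart, glue, h]

/-- **Fubini across the separator**: a sum over all inputs is the iterated sum over `A`-parts and `B`-parts of the glued input. -/
theorem sum_eq_sum_glue (m : ℕ) (f : (Fin n → Bool) → ℝ) :
    (∑ u, f u) = ∑ s ∈ Aset n m, ∑ t ∈ Bset n m, f (glue m s t) := by
  rw [← sum_product']
  refine sum_nbij' (fun u => (loPart m u, hiPart m u)) (fun st => glue m st.1 st.2) ?_ ?_ ?_ ?_ ?_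
  · intro u _; exact mem_product.mpr ⟨loPart_mem_Aset m u, hiPart_mem_Bset m u⟩
  · intro st _; exact mem_univ _
  · intro u _; exact glue_loPart_hiPart m u
  · intro st hst
    obtain ⟨hs, ht⟩ := mem_product.mp hst
    exact Prod.ext (loPart_glue hs st.2) (hiPart_glue ht st.1)
  · intro u _; rw [glue_loPart_hiPart]

/-- a sum over the `A`-parts is the sum over the three classes. -/
theorem sum_Aset_eq_sum_Acl (m : ℕ) (f : (Fin n → Bool) → ℝ) :
    (∑ s ∈ Aset n m, f s) = ∑ a : Fin 3, ∑ s ∈ Acl n m a.val, f s := by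
  rw [← sum_fiberwise_of_maps_to (s := Aset n m) (t := range 3) (g := fun s => wtA m s % 3)
    (fun s _ => mem_range.mpr (Nat.mod_lt _ (by norm_num))), sum_range]
  rfl

/-- a sum over the `B`-parts is the sum over the three classes. -/
theorem sum_Bset_eq_sum_Bcl (m : ℕ) (f : (Fin n → Bool) → ℝ) :
    (∑ t ∈ Bset n m, f t) = ∑ b : Fin 3, ∑ t ∈ Bcl n m b.val, f t := by
  rw [← sum_fiberwise_of_maps_to (s := Bset n m) (t := range 3) (g := fun t => wtB m t % 3)
    (fun t _ => mem_range.mpr (Nat.mod_lt _ (by norm_num))), sum_range]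
  rfl

/-! ### §2 Class sizes: transport to the cubes `{0,1}^m` and `{0,1}^(n-m)` -/

/-- the `A`-weight of an input is the weight of its restriction to the first `m` coordinates. -/
theorem wtA_eq_wt_restrict {m : ℕ} (hm : m ≤ n) (s : Fin n → Bool) :
    wtA m s = wt (fun j : Fin m => s (Fin.castLE hm j)) := by
  unfold wtA wt
  refine card_bij' (fun i hi => ⟨i.val, (mem_filter.mp hi).2.1⟩) (fun j _ => Fin.castLE hm j) ?_ ?_ ?_ ?_
  · intro i hi
    obtain ⟨_, _, h2⟩ := mem_filter.mp hi
    simp only [mem_filter, mem_univ, true_and]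
    have e : Fin.castLE hm ⟨i.val, (mem_filter.mp hi).2.1⟩ = i := Fin.ext rfl
    rw [e]; exact h2
  · intro j hj
    simp only [mem_filter, mem_univ, true_and] at hj ⊢
    exact ⟨j.isLt, hj⟩
  · intro i _; exact Fin.ext rfl
  · intro j _; exact Fin.ext rfl

/-- the `B`-weight of an input is the weight of its restriction to the last `n - m` coordinates. -/
theorem wtB_eq_wt_restrict {m : ℕ} (hm : m ≤ n) (t : Fin n → Bool) :
    wtB m t = wt (fun j : Fin (n - m) => t ⟨m + j.val, by omega⟩) := by
  unfold wtB wt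
  refine card_bij' (fun i hi => ⟨i.val - m, by have := (mem_filter.mp hi).2.1; omega⟩)
    (fun j _ => (⟨m + j.val, by omega⟩ : Fin n)) ?_ ?_ ?_ ?_
  · intro i hi
    obtain ⟨_, h1, h2⟩ := mem_filter.mp hi
    simp only [mem_filter, mem_univ, true_and]
    have e : (⟨m + (i.val - m), by omega⟩ : Fin n) = i := Fin.ext (by simp only; omega)
    rw [e]; exact h2
  · intro j hj
    simp only [mem_filter, mem_univ, true_and] at hj ⊢
    exact ⟨by omega, hj⟩
  · intro i hi
    have h1 := (mem_filter.mp hi).2.1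
    exact Fin.ext (by simp only; omega)
  · intro j _; exact Fin.ext (by simp)

/-- `|Acl n m a| = #{v ∈ {0,1}^m : |v| ≡ a (mod 3)}`. -/
theorem card_Acl {m : ℕ} (hm : m ≤ n) (a : ℕ) :
    (Acl n m a).card = (univ.filter fun v : Fin m → Bool => wt v % 3 = a).card := by
  refine card_nbij' (fun s => fun j : Fin m => s (Fin.castLE hm j))
    (fun v => fun i : Fin n => if h : i.val < m then v ⟨i.val, h⟩ else false) ?_ ?_ ?_ ?_
  · intro s hs
    have hs' := mem_filter.mp (mem_coe.mp hs)
    rw [mem_coe, mem_filter, ← wtA_eq_wt_restrict hm s]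
    exact ⟨mem_univ _, hs'.2⟩
  · intro v hv
    have hv' := (mem_filter.mp (mem_coe.mp hv)).2
    rw [mem_coe]
    refine mem_filter.mpr ⟨mem_filter.mpr ⟨mem_univ _, fun i hi => by simp [hi]⟩, ?_⟩
    rw [wtA_eq_wt_restrict hm, ← hv']
    congr 2
    funext j
    simp [Fin.castLE, j.isLt]
  · intro s hs
    have hs' := (mem_filter.mp (mem_filter.mp (mem_coe.mp hs)).1).2
    funext i
    by_cases h : i.val < m
    · simp only [h, dif_pos]; rfl
    · simp only [h, dif_neg, not_false_eq_true]; exact (hs' i h).symm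
  · intro v _; funext j; simp [Fin.castLE, j.isLt]

/-- `|Bcl n m b| = #{v ∈ {0,1}^(n-m) : |v| ≡ b (mod 3)}`. -/
theorem card_Bcl {m : ℕ} (hm : m ≤ n) (b : ℕ) :
    (Bcl n m b).card = (univ.filter fun v : Fin (n - m) → Bool => wt v % 3 = b).card := by
  refine card_nbij' (fun t => fun j : Fin (n - m) => t ⟨m + j.val, by omega⟩)
    (fun v => fun i : Fin n => if h : m ≤ i.val then v ⟨i.val - m, by omega⟩ else false) ?_ ?_ ?_ ?_
  · intro t ht
    have ht' := mem_filter.mp (mem_coe.mp ht)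
    rw [mem_coe, mem_filter, ← wtB_eq_wt_restrict hm t]
    exact ⟨mem_univ _, ht'.2⟩
  · intro v hv
    have hv' := (mem_filter.mp (mem_coe.mp hv)).2
    rw [mem_coe]
    refine mem_filter.mpr ⟨mem_filter.mpr ⟨mem_univ _, fun i hi => by
      have : ¬ m ≤ i.val := by omega
      simp [this]⟩, ?_⟩
    rw [wtB_eq_wt_restrict hm, ← hv']
    congr 2
    funext j
    simp
  · intro t ht
    have ht' := (mem_filter.mp (mem_filter.mp (mem_coe.mp ht)).1).2
    funext i
    by_cases h : m ≤ i.val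
    · simp only [h, dif_pos]
      congr 1; exact Fin.ext (by simp only; omega)
    · simp only [h, dif_neg, not_false_eq_true]; exact (ht' i (by omega)).symm
  · intro v _; funext j; simp

/-- every `A`-class has at least `(2^m - 2)/3` members. -/
theorem pow_le_card_Acl {m : ℕ} (hm : m ≤ n) {a : ℕ} (ha : a < 3) : 2 ^ m ≤ 3 * (Acl n m a).card + 2 := by
  have h := three_mul_card_class_add_two_ge m a
  rwa [Nat.mod_eq_of_lt ha, ← card_Acl hm a] at h

/-- every `B`-class has at least `(2^(n-m) - 2)/3` members. -/
theorem pow_le_card_Bcl {m : ℕ} (hm : m ≤ n) {b : ℕ} (hb : b < 3) :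
    2 ^ (n - m) ≤ 3 * (Bcl n m b).card + 2 := by
  have h := three_mul_card_class_add_two_ge (n - m) b
  rwa [Nat.mod_eq_of_lt hb, ← card_Bcl hm b] at h

/-! ### §3 The two pigeonholes -/

section Game

variable (m c : ℕ) (y : Fin (n + 1) → (Fin n → Bool) → Bool)

/-- the `B`-parts of class `b` that LOSE against the `A`-part `s`. -/
def badB (b : ℕ) (s : Fin n → Bool) : Finset (Fin n → Bool) :=
  (Bcl n m b).filter fun t => ¬ ringWinU c y (glue m s t) = true

/-- the cost of an `A`-part: the sum over the three `B`-classes of its losing fractions. -/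
noncomputable def cost (s : Fin n → Bool) : ℝ :=
  ∑ b : Fin 3, ((badB m c y b.val s).card : ℝ) / ((Bcl n m b.val).card : ℝ)

/-- the cost is non-negative. -/
theorem cost_nonneg (s : Fin n → Bool) : 0 ≤ cost m c y s :=
  sum_nonneg fun _ _ => div_nonneg (Nat.cast_nonneg _) (Nat.cast_nonneg _)

variable {m c y}

/-- **First pigeonhole.**  Under blindness, every system of `A`-class representatives has total cost `≥ 1`:
otherwise each `B`-class contains a part beating all three representatives, contradicting `blind_exists_lose`. -/
theorem one_le_sum_cost
    (hA : ∀ g : Fin (n + 1), ∀ u u' : Fin n → Bool, g.val ≤ m →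
      (∀ i : Fin n, i.val < m → u i = u' i) → y g u = y g u')
    (hB : ∀ g : Fin (n + 1), ∀ u u' : Fin n → Bool, m < g.val →
      (∀ i : Fin n, m ≤ i.val → u i = u' i) → y g u = y g u')
    (hBpos : ∀ b : Fin 3, 0 < (Bcl n m b.val).card)
    (p : Fin 3 → Fin n → Bool) (hp : ∀ a : Fin 3, p a ∈ Acl n m a.val) :
    1 ≤ ∑ a : Fin 3, cost m c y (p a) := by
  by_contra hlt
  push Not at hlt
  -- each `B`-class has a member outside the three bad sets
  have hfree : ∀ b : Fin 3, ∃ t, t ∈ Bcl n m b.val ∧ t ∉ univ.biUnion fun a => badB m c y b.val (p a) := by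
    intro b
    apply exists_mem_notMem_of_card_lt_card
    have hBb : (0 : ℝ) < (Bcl n m b.val).card := by exact_mod_cast hBpos b
    have hslice : (∑ a : Fin 3, ((badB m c y b.val (p a)).card : ℝ) / (Bcl n m b.val).card) < 1 := by
      refine lt_of_le_of_lt (sum_le_sum fun a _ => ?_) hlt
      exact single_le_sum (f := fun b' : Fin 3 => ((badB m c y b'.val (p a)).card : ℝ) / (Bcl n m b'.val).card)
        (fun _ _ => div_nonneg (Nat.cast_nonneg _) (Nat.cast_nonneg _)) (mem_univ b)
    rw [← sum_div, div_lt_one hBb] at hslice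
    have hU := card_biUnion_le (s := (univ : Finset (Fin 3))) (t := fun a => badB m c y b.val (p a))
    have hlt' : (∑ a : Fin 3, (badB m c y b.val (p a)).card) < (Bcl n m b.val).card := by exact_mod_cast hslice
    exact lt_of_le_of_lt hU hlt'
  choose q hq using hfree
  obtain ⟨a, b, hlose⟩ := blind_exists_lose m c y hA hB p q
    (fun a => (mem_filter.mp (hp a)).2) (fun b => (mem_filter.mp (hq b).1).2)
  have hnot := (hq b).2
  rw [mem_biUnion] at hnot
  exact hnot ⟨a, mem_univ _, mem_filter.mpr ⟨(hq b).1, by simp [hlose]⟩⟩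

/-- **Second pigeonhole (double count).**  Under blindness the number of LOST inputs is at least
`(min_a |A_a|)·(min_b |B_b|)`: `#LOSE = Σ_s Σ_b |bad_b(s)| ≥ (min |B_b|)·Σ_s cost(s)`, and on each `A`-class the cost sum is at
least `|A_a|·cost(p_a)` for a minimiser `p_a`, while `Σ_a cost(p_a) ≥ 1`. -/
theorem mul_le_card_lose
    (hA : ∀ g : Fin (n + 1), ∀ u u' : Fin n → Bool, g.val ≤ m →
      (∀ i : Fin n, i.val < m → u i = u' i) → y g u = y g u')
    (hB : ∀ g : Fin (n + 1), ∀ u u' : Fin n → Bool, m < g.val →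
      (∀ i : Fin n, m ≤ i.val → u i = u' i) → y g u = y g u')
    (hApos : ∀ a : Fin 3, 0 < (Acl n m a.val).card) (hBpos : ∀ b : Fin 3, 0 < (Bcl n m b.val).card)
    {MA MB : ℝ} (hMA0 : 0 ≤ MA) (hMB0 : 0 ≤ MB)
    (hMA : ∀ a : Fin 3, MA ≤ (Acl n m a.val).card) (hMB : ∀ b : Fin 3, MB ≤ (Bcl n m b.val).card) :
    MA * MB ≤ ((univ.filter fun u : Fin n → Bool => ¬ ringWinU c y u = true).card : ℝ) := by
  -- minimisers of the cost on each `A`-class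
  have hmin : ∀ a : Fin 3, ∃ s ∈ Acl n m a.val, ∀ s' ∈ Acl n m a.val, cost m c y s ≤ cost m c y s' :=
    fun a => exists_min_image _ _ (card_pos.mp (hApos a))
  choose p hp hpmin using hmin
  have h1 := one_le_sum_cost (c := c) hA hB hBpos p hp
  -- #LOSE as an iterated sum
  have hL : ((univ.filter fun u : Fin n → Bool => ¬ ringWinU c y u = true).card : ℝ)
      = ∑ s ∈ Aset n m, ∑ b : Fin 3, ((badB m c y b.val s).card : ℝ) := by
    rw [natCast_card_filter, sum_eq_sum_glue m]
    refine sum_congr rfl fun s _ => ?_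
    rw [sum_Bset_eq_sum_Bcl m]
    refine sum_congr rfl fun b _ => ?_
    rw [badB, natCast_card_filter]
  -- inner bound: Σ_b |bad_b(s)| ≥ MB · cost s
  have hinner : ∀ s, MB * cost m c y s ≤ ∑ b : Fin 3, ((badB m c y b.val s).card : ℝ) := by
    intro s
    rw [cost, mul_sum]
    refine sum_le_sum fun b _ => ?_
    have hBb : (0 : ℝ) < (Bcl n m b.val).card := by exact_mod_cast hBpos b
    calc MB * (((badB m c y b.val s).card : ℝ) / (Bcl n m b.val).card)
        ≤ ((Bcl n m b.val).card : ℝ) * (((badB m c y b.val s).card : ℝ) / (Bcl n m b.val).card) :=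
          mul_le_mul_of_nonneg_right (hMB b) (div_nonneg (Nat.cast_nonneg _) (Nat.cast_nonneg _))
      _ = ((badB m c y b.val s).card : ℝ) := mul_div_cancel₀ _ (ne_of_gt hBb)
  -- outer bound: Σ_{s ∈ A_a} cost s ≥ MA · cost (p a)
  have houter : ∀ a : Fin 3, MA * cost m c y (p a) ≤ ∑ s ∈ Acl n m a.val, cost m c y s := by
    intro a
    calc MA * cost m c y (p a) ≤ ((Acl n m a.val).card : ℝ) * cost m c y (p a) :=
          mul_le_mul_of_nonneg_right (hMA a) (cost_nonneg m c y _)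
      _ = ∑ _s ∈ Acl n m a.val, cost m c y (p a) := by rw [sum_const, nsmul_eq_mul]
      _ ≤ ∑ s ∈ Acl n m a.val, cost m c y s := sum_le_sum fun s hs => hpmin a s hs
  calc MA * MB = MB * (MA * 1) := by ring
    _ ≤ MB * (MA * ∑ a : Fin 3, cost m c y (p a)) :=
        mul_le_mul_of_nonneg_left (mul_le_mul_of_nonneg_left h1 hMA0) hMB0
    _ = MB * ∑ a : Fin 3, MA * cost m c y (p a) := by rw [mul_sum]
    _ ≤ MB * ∑ a : Fin 3, ∑ s ∈ Acl n m a.val, cost m c y s :=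
        mul_le_mul_of_nonneg_left (sum_le_sum fun a _ => houter a) hMB0
    _ = MB * ∑ s ∈ Aset n m, cost m c y s := by rw [← sum_Aset_eq_sum_Acl]
    _ = ∑ s ∈ Aset n m, MB * cost m c y s := by rw [mul_sum]
    _ ≤ ∑ s ∈ Aset n m, ∑ b : Fin 3, ((badB m c y b.val s).card : ℝ) := sum_le_sum fun s _ => hinner s
    _ = _ := hL.symm

end Game

/-! ### §4 The blind pair law -/

/-- **BLIND PAIR LAW `8/9`** (item stmt-QuantumAdvantage-23990, engine form): no cut crosses the separator `m`, both sides
`≥ m₀` bits ⇒ `#WIN ≤ (8/9 + 8·2^{-m₀})·2^n`. -/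
theorem blindPairLaw_card (m₀ n m c : ℕ) (y : Fin (n + 1) → (Fin n → Bool) → Bool)
    (hm₀ : m₀ ≤ m) (hmn : m + m₀ ≤ n)
    (hA : ∀ g : Fin (n + 1), ∀ u u' : Fin n → Bool, g.val ≤ m →
      (∀ i : Fin n, i.val < m → u i = u' i) → y g u = y g u')
    (hB : ∀ g : Fin (n + 1), ∀ u u' : Fin n → Bool, m < g.val →
      (∀ i : Fin n, m ≤ i.val → u i = u' i) → y g u = y g u') :
    ((univ.filter fun u : Fin n → Bool => ringWinU c y u = true).card : ℝ)
      ≤ (8 / 9 + 8 * (2 : ℝ)⁻¹ ^ m₀) * (2 : ℝ) ^ n := by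
  have htot : ((univ.filter fun u : Fin n → Bool => ringWinU c y u = true).card : ℝ)
      + ((univ.filter fun u : Fin n → Bool => ¬ ringWinU c y u = true).card : ℝ) = (2 : ℝ) ^ n := by
    have h := card_filter_add_card_filter_not (s := (univ : Finset (Fin n → Bool)))
      (fun u : Fin n → Bool => ringWinU c y u = true)
    rw [card_univ, Fintype.card_fun, Fintype.card_bool, Fintype.card_fin] at h
    exact_mod_cast h
  have hWle : ((univ.filter fun u : Fin n → Bool => ringWinU c y u = true).card : ℝ) ≤ (2 : ℝ) ^ n := by
    have : (0 : ℝ) ≤ ((univ.filter fun u : Fin n → Bool => ¬ ringWinU c y u = true).card : ℝ) := Nat.cast_nonneg _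
    linarith
  have h2n : (0 : ℝ) ≤ (2 : ℝ) ^ n := by positivity
  by_cases hsmall : m₀ ≤ 6
  · -- trivial regime: the bound exceeds `2^n`
    have hpow : (2 : ℝ)⁻¹ ^ 6 ≤ (2 : ℝ)⁻¹ ^ m₀ :=
      pow_le_pow_of_le_one (by norm_num) (by norm_num) hsmall
    have h1 : (1 : ℝ) ≤ 8 / 9 + 8 * (2 : ℝ)⁻¹ ^ m₀ := by norm_num at hpow ⊢; linarith
    calc ((univ.filter fun u : Fin n → Bool => ringWinU c y u = true).card : ℝ) ≤ 1 * (2 : ℝ) ^ n := by linarith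
      _ ≤ (8 / 9 + 8 * (2 : ℝ)⁻¹ ^ m₀) * (2 : ℝ) ^ n := mul_le_mul_of_nonneg_right h1 h2n
  · -- main regime: `m ≥ 7`, `n - m ≥ 7`
    have hm7 : 7 ≤ m := by omega
    have hk7 : 7 ≤ n - m := by omega
    have hmn' : m ≤ n := by omega
    have hAcard : ∀ a : Fin 3, 2 ^ m ≤ 3 * (Acl n m a.val).card + 2 := fun a => pow_le_card_Acl hmn' a.isLt
    have hBcard : ∀ b : Fin 3, 2 ^ (n - m) ≤ 3 * (Bcl n m b.val).card + 2 := fun b => pow_le_card_Bcl hmn' b.isLt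
    have h128m : 2 ^ 7 ≤ 2 ^ m := Nat.pow_le_pow_right (by norm_num) hm7
    have h128k : 2 ^ 7 ≤ 2 ^ (n - m) := Nat.pow_le_pow_right (by norm_num) hk7
    have hApos : ∀ a : Fin 3, 0 < (Acl n m a.val).card := fun a => by have := hAcard a; omega
    have hBpos : ∀ b : Fin 3, 0 < (Bcl n m b.val).card := fun b => by have := hBcard b; omega
    set X : ℝ := (2 : ℝ) ^ m with hX
    set Y : ℝ := (2 : ℝ) ^ (n - m) with hY
    have hX2 : (2 : ℝ) ^ 7 ≤ X := by rw [hX]; exact_mod_cast h128m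
    have hY2 : (2 : ℝ) ^ 7 ≤ Y := by rw [hY]; exact_mod_cast h128k
    have hMA : ∀ a : Fin 3, (X - 2) / 3 ≤ ((Acl n m a.val).card : ℝ) := by
      intro a
      have h : (2 : ℝ) ^ m ≤ 3 * ((Acl n m a.val).card : ℝ) + 2 := by exact_mod_cast hAcard a
      rw [hX]; linarith
    have hMB : ∀ b : Fin 3, (Y - 2) / 3 ≤ ((Bcl n m b.val).card : ℝ) := by
      intro b
      have h : (2 : ℝ) ^ (n - m) ≤ 3 * ((Bcl n m b.val).card : ℝ) + 2 := by exact_mod_cast hBcard b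
      rw [hY]; linarith
    have hlose := mul_le_card_lose (c := c) hA hB hApos hBpos (MA := (X - 2) / 3) (MB := (Y - 2) / 3)
      (by norm_num at hX2 ⊢; linarith) (by norm_num at hY2 ⊢; linarith) hMA hMB
    -- arithmetic
    have hXY : X * Y = (2 : ℝ) ^ n := by
      rw [hX, hY, ← pow_add]; congr 1; omega
    have hZ : (2 : ℝ)⁻¹ ^ m₀ * (2 : ℝ) ^ n = (2 : ℝ) ^ (n - m₀) := by
      have e : n = m₀ + (n - m₀) := by omega
      rw [e, pow_add, ← mul_assoc, inv_pow, inv_mul_cancel₀ (by positivity), one_mul]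
      congr 1; omega
    have hXZ : X ≤ (2 : ℝ) ^ (n - m₀) := by rw [hX]; exact pow_le_pow_right₀ (by norm_num) (by omega)
    have hYZ : Y ≤ (2 : ℝ) ^ (n - m₀) := by rw [hY]; exact pow_le_pow_right₀ (by norm_num) (by omega)
    have hZ0 : (0 : ℝ) ≤ (2 : ℝ) ^ (n - m₀) := by positivity
    have key : (2 : ℝ) ^ n - (X - 2) / 3 * ((Y - 2) / 3) ≤ (8 / 9 + 8 * (2 : ℝ)⁻¹ ^ m₀) * (2 : ℝ) ^ n := by
      rw [add_mul, mul_assoc, hZ, ← hXY]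
      nlinarith
    linarith

end Summit.QuantumAdvantage.AdviceFreeQNC0.OddConfig

namespace Summit.QuantumAdvantage.QuantumAdvantage.Theorems

set_option linter.dupNamespace false

/-- **Item stmt-QuantumAdvantage-23990 `BlindPairLaw` (route OddPrimeWalk, support, rank 9; planner qa-qnc0-p2 g28/g29 ROUND-28 THM 1 /
ROUND-29 §1.1; prover qn-prover-3 g18).**  In the u-walk game, if no cut crosses position `m` (cuts `g ≤ m` read only bits `< m`, cuts
`g > m` only bits `≥ m`) and both sides have `≥ m₀` bits, then `#win ≤ (8/9 + 8·2^{-m₀})·2^n` at every charge. -/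
theorem oddPrimeWalk_blindPairLaw : Summit.QuantumAdvantage.QuantumAdvantage.Theses.OddPrimeWalk.BlindPairLaw := by
  intro m₀ n m c y hm₀ hmn hA hB
  exact Summit.QuantumAdvantage.AdviceFreeQNC0.OddConfig.blindPairLaw_card m₀ n m c y hm₀ hmn hA hB

end Summit.QuantumAdvantage.QuantumAdvantage.Theorems
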